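import Summits.BirchSwinnertonDyer.Rank1Residual.GaloisImage.TorsionIsoImageObstruction
import Literature.NumberTheory.SerreUniformity.SplitCartan
import Literature.NumberTheory.SerreUniformity.Statement
import HarnessLib

/-!
# The Cartan-type image predicates are CONGRUENCE INVARIANTS: a `Γ_ℚ`-equivariant `E₁[p] ≃ E₂[p]`
# transports "image in a split / non-split Cartan normaliser" and "image = non-split Cartan
# normaliser" (cell `b2b-bsdres`, lane CLASS-CLOSURE, seat cc-typer-1 = typer of the joint
# small-image axis O8 / N2 / N3; sequel of `TorsionIsoImageObstruction.lean`, n1011-p04)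

HONEST FRAMING (run/shared/lean/b2b/bsd-rank1-residual/, verbatim in every file): the goal of the
cell is to DELETE the COMBINATION-SHAPED residual classes of the Birch–Swinnerton-Dyer formula for
ALL analytic-rank `≤ 1` elliptic curves over `ℚ` — "full BSD formula for every rank `≤ 1` curve in
class `C`" assembled STRICTLY from published theorems — so that the rank-`≤ 1` remainder becomes
exactly the CONSTRUCTION-SHAPED classes, which are TYPED (missing-input `Prop`s), NOT attempted.
This is not "finishing BSD". Lane CLASS-CLOSURE: research routes; no claim beyond stated classes;
the E3 relation tables are EVIDENCE (screened congruences, not certified); nothing here is booked.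
THEOREMS ONLY (no definition, no named fact; labels unchanged).

## What this file proves

`TorsionIsoImageObstruction.lean` (n1011-p04) transports surjectivity and the small-image
obstruction `Irr ∧ ¬Surj` along a `Γ_ℚ`-equivariant additive isomorphism
`e : E₁[p] ≃+ E₂[p]`. Here the FINER image types used by the O8 / N2 / N3 sub-partitions
(`class-closure/{O8,N2,N3}/STATEMENT.md`, Sutherland codes `pNs` / `pNn`) are transported the same
way — the tree's predicates are basis statements on `E[p]`, and a basis of `E₂[p]` is obtained by
precomposing a basis of `E₁[p]` with `e⁻¹`:

* `hasSplitCartanNormalizerModPImage_of_torsionIso` / `_iff_`: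
  `SerreUniformity.HasSplitCartanNormalizerModPImage` (`pNs`-or-smaller) is a congruence invariant;
* `hasNonsplitCartanModPImage_of_torsionIso` / `_iff_`:
  `SerreUniformity.HasNonsplitCartanModPImage` (image inside some `C_ns⁺(ε)`);
* `hasModPImageEqNonsplitCartanNormalizer_of_torsionIso` / `_iff_`:
  `SerreUniformity.HasModPImageEqNonsplitCartanNormalizer` (image EQUAL to `C_ns⁺(ε)`, `pNn`).

Use (the typer's T5 control C-IMG-CONG for the transport-search instruments `translinks` /
`congruence-screen`, ttrl/requests.jsonl l.1474): a screened mod-`p` congruence whose two sides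
carry different image codes at `p` cannot be certified; a genuine congruent partner of an N2
(`3Ns`/`3Nn`), N3 (`5Ns`/`7Ns`) or O8 Cartan-type cell has the same Cartan type. (The exceptional
`𝔖₄` type has no named tree predicate; its invariance is the complement statement and is not
spelled out.) Nothing booked; O8, N2, N3 stay OPEN.

References: J.-P. Serre, Invent. Math. 15 (1972) §2 [Serre1972]; R. Greenberg, V. Vatsal, Invent.
Math. 142 (2000) (congruent curves: `E₁[p] ≅ E₂[p]`) [GreenbergVatsal2000]; Bilu–Parent–Rebolledo
2013 §1 (split Cartan normaliser) [BiluParentRebolledo2013]; Furio–Lombardo (non-split Cartan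
normaliser) [FurioLombardo2023]; cell files class-closure/N2/STATEMENT.md §3,
class-closure/N3/STATEMENT.md §3, class-closure/relations/CS-CATALOGUE.md.
-/

noncomputable section

open scoped Classical

open WeierstrassCurve Literature.NumberTheory.EllipticCurves
  Literature.NumberTheory.EllipticCurves.Rank1Residual Literature.NumberTheory.SerreUniformity

namespace Summit.BirchSwinnertonDyer.Rank1Residual.GaloisImage

variable {W₁ W₂ : WeierstrassCurve ℚ} {p : ℕ}

/-- Basis transport: a `ℤ/p`-basis `b` of `E₁[p]` in which `Γ_ℚ` acts through matrices of a set
`S`, and a `Γ_ℚ`-equivariant `e : E₁[p] ≃+ E₂[p]`, give the basis `b ∘ e⁻¹` of `E₂[p]` in which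
`Γ_ℚ` acts through the SAME matrices. [folklore] -/
theorem exists_basis_of_torsionIso {S : Set (Matrix (Fin 2) (Fin 2) (ZMod p))}
    (e : geomTorsion W₁ (p : ℤ) ≃+ geomTorsion W₂ (p : ℤ))
    (he : ∀ (σ : Field.absoluteGaloisGroup ℚ) (P : geomTorsion W₁ (p : ℤ)), e (σ • P) = σ • e P)
    (b : geomTorsion W₁ (p : ℤ) ≃+ (Fin 2 → ZMod p))
    (hb : ∀ σ : Field.absoluteGaloisGroup ℚ, ∃ M ∈ S,
      ∀ P : geomTorsion W₁ (p : ℤ), b (σ • P) = M.mulVec (b P)) :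
    ∀ σ : Field.absoluteGaloisGroup ℚ, ∃ M ∈ S,
      ∀ Q : geomTorsion W₂ (p : ℤ), (e.symm.trans b) (σ • Q) = M.mulVec ((e.symm.trans b) Q) := by
  intro σ
  obtain ⟨M, hM, hσ⟩ := hb σ
  refine ⟨M, hM, fun Q ↦ ?_⟩
  rw [AddEquiv.trans_apply, AddEquiv.trans_apply, torsionIso_symm_smul e he, hσ]

/-- **"Image in the normaliser of a split Cartan subgroup" is a congruence invariant**: transported
along a `Γ_ℚ`-equivariant `E₁[p] ≃+ E₂[p]`. [cite: BiluParentRebolledo2013, §1 (Cor. 1.2 and the paragraph before it)] -/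
theorem hasSplitCartanNormalizerModPImage_of_torsionIso
    (e : geomTorsion W₁ (p : ℤ) ≃+ geomTorsion W₂ (p : ℤ))
    (he : ∀ (σ : Field.absoluteGaloisGroup ℚ) (P : geomTorsion W₁ (p : ℤ)), e (σ • P) = σ • e P)
    (h : HasSplitCartanNormalizerModPImage W₁ p) : HasSplitCartanNormalizerModPImage W₂ p := by
  obtain ⟨b, hb⟩ := h
  exact ⟨e.symm.trans b, exists_basis_of_torsionIso e he b hb⟩

/-- `pNs`-type ⟺ `pNs`-type across a `Γ_ℚ`-isomorphism `E₁[p] ≃ E₂[p]`. [cite: BiluParentRebolledo2013, §1] -/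
theorem hasSplitCartanNormalizerModPImage_iff_of_torsionIso
    (e : geomTorsion W₁ (p : ℤ) ≃+ geomTorsion W₂ (p : ℤ))
    (he : ∀ (σ : Field.absoluteGaloisGroup ℚ) (P : geomTorsion W₁ (p : ℤ)), e (σ • P) = σ • e P) :
    HasSplitCartanNormalizerModPImage W₁ p ↔ HasSplitCartanNormalizerModPImage W₂ p :=
  ⟨hasSplitCartanNormalizerModPImage_of_torsionIso e he,
    hasSplitCartanNormalizerModPImage_of_torsionIso e.symm (torsionIso_symm_smul e he)⟩

/-- **"Image in the normaliser of a non-split Cartan subgroup" is a congruence invariant.**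
[cite: FurioLombardo2023, §1 (1.1)] -/
theorem hasNonsplitCartanModPImage_of_torsionIso
    (e : geomTorsion W₁ (p : ℤ) ≃+ geomTorsion W₂ (p : ℤ))
    (he : ∀ (σ : Field.absoluteGaloisGroup ℚ) (P : geomTorsion W₁ (p : ℤ)), e (σ • P) = σ • e P)
    (h : HasNonsplitCartanModPImage W₁ p) : HasNonsplitCartanModPImage W₂ p := by
  obtain ⟨b, ε, hε, hb⟩ := h
  exact ⟨e.symm.trans b, ε, hε, exists_basis_of_torsionIso e he b hb⟩

/-- Non-split-normaliser containment ⟺ across a `Γ_ℚ`-isomorphism `E₁[p] ≃ E₂[p]`.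
[cite: FurioLombardo2023, §1 (1.1)] -/
theorem hasNonsplitCartanModPImage_iff_of_torsionIso
    (e : geomTorsion W₁ (p : ℤ) ≃+ geomTorsion W₂ (p : ℤ))
    (he : ∀ (σ : Field.absoluteGaloisGroup ℚ) (P : geomTorsion W₁ (p : ℤ)), e (σ • P) = σ • e P) :
    HasNonsplitCartanModPImage W₁ p ↔ HasNonsplitCartanModPImage W₂ p :=
  ⟨hasNonsplitCartanModPImage_of_torsionIso e he,
    hasNonsplitCartanModPImage_of_torsionIso e.symm (torsionIso_symm_smul e he)⟩

/-- **"Image EQUAL to the normaliser of a non-split Cartan subgroup" (`pNn`) is a congruence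
invariant**: both the containment and the "every matrix of `C_ns⁺(ε)` is realised by some `σ`"
clauses transport (the same `σ` realises the same matrix in the transported basis).
[cite: FurioLombardo2023, Thm. 1.5] -/
theorem hasModPImageEqNonsplitCartanNormalizer_of_torsionIso
    (e : geomTorsion W₁ (p : ℤ) ≃+ geomTorsion W₂ (p : ℤ))
    (he : ∀ (σ : Field.absoluteGaloisGroup ℚ) (P : geomTorsion W₁ (p : ℤ)), e (σ • P) = σ • e P)
    (h : HasModPImageEqNonsplitCartanNormalizer W₁ p) :
    HasModPImageEqNonsplitCartanNormalizer W₂ p := by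
  obtain ⟨b, ε, hε, hb, hsurj⟩ := h
  refine ⟨e.symm.trans b, ε, hε, exists_basis_of_torsionIso e he b hb, fun M hM ↦ ?_⟩
  obtain ⟨σ, hσ⟩ := hsurj M hM
  refine ⟨σ, fun Q ↦ ?_⟩
  rw [AddEquiv.trans_apply, AddEquiv.trans_apply, torsionIso_symm_smul e he, hσ]

/-- `pNn` ⟺ `pNn` across a `Γ_ℚ`-isomorphism `E₁[p] ≃ E₂[p]`. [cite: FurioLombardo2023, Thm. 1.5] -/
theorem hasModPImageEqNonsplitCartanNormalizer_iff_of_torsionIso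
    (e : geomTorsion W₁ (p : ℤ) ≃+ geomTorsion W₂ (p : ℤ))
    (he : ∀ (σ : Field.absoluteGaloisGroup ℚ) (P : geomTorsion W₁ (p : ℤ)), e (σ • P) = σ • e P) :
    HasModPImageEqNonsplitCartanNormalizer W₁ p ↔ HasModPImageEqNonsplitCartanNormalizer W₂ p :=
  ⟨hasModPImageEqNonsplitCartanNormalizer_of_torsionIso e he,
    hasModPImageEqNonsplitCartanNormalizer_of_torsionIso e.symm (torsionIso_symm_smul e he)⟩

/-- **No congruence crosses Cartan types in the direction `pNs → ¬pNs`**: a `Γ_ℚ`-isomorphism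
`E₁[p] ≃ E₂[p]` with `E₁` of split-normaliser type forces `E₂` to be of split-normaliser type; read
contrapositively, a screened link between a `pNs` cell and a curve NOT of that type is not a
congruence (control C-IMG-CONG). [cite: BiluParentRebolledo2013, §1] -/
theorem not_torsionIso_of_splitCartan_of_not (h₁ : HasSplitCartanNormalizerModPImage W₁ p)
    (h₂ : ¬ HasSplitCartanNormalizerModPImage W₂ p) :
    ¬ ∃ e : geomTorsion W₁ (p : ℤ) ≃+ geomTorsion W₂ (p : ℤ),
      ∀ (σ : Field.absoluteGaloisGroup ℚ) (P : geomTorsion W₁ (p : ℤ)), e (σ • P) = σ • e P := by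
  rintro ⟨e, he⟩
  exact h₂ (hasSplitCartanNormalizerModPImage_of_torsionIso e he h₁)

/-- The same for the `pNn` type. [cite: FurioLombardo2023, Thm. 1.5] -/
theorem not_torsionIso_of_nonsplitCartanNormalizer_of_not
    (h₁ : HasModPImageEqNonsplitCartanNormalizer W₁ p)
    (h₂ : ¬ HasModPImageEqNonsplitCartanNormalizer W₂ p) :
    ¬ ∃ e : geomTorsion W₁ (p : ℤ) ≃+ geomTorsion W₂ (p : ℤ),
      ∀ (σ : Field.absoluteGaloisGroup ℚ) (P : geomTorsion W₁ (p : ℤ)), e (σ • P) = σ • e P := by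
  rintro ⟨e, he⟩
  exact h₂ (hasModPImageEqNonsplitCartanNormalizer_of_torsionIso e he h₁)

end Summit.BirchSwinnertonDyer.Rank1Residual.GaloisImage

end
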